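import Summits.BirchSwinnertonDyer.Rank1Residual.Additive.TwistPartnerTameBranchOfDelbourgo
import Literature.NumberTheory.EllipticCurves.LeadingTermPPartProofs
import HarnessLib

/-!
# Rank ZERO on defect 3, 4, 6 (census arm X4-3): `λ(X(E/ℚ_∞)) = 0` and the valuation identity from
# PRINT ALONE plus ONE number `ord_p[0]⁺_f` — no unit root, no sign certificate, no Riemann sum
# (cell `b2b-bsdres`, sub-cell additive-p2 = X3♯(G-ord)/X4♯(G-ord), gen 26)

HONEST FRAMING (cell `b2b-bsdres`, run/shared/lean/b2b/bsd-rank1-residual/, verbatim in every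
file): the goal of the cell is to DELETE the COMBINATION-SHAPED residual classes of the
Birch–Swinnerton-Dyer formula for ALL analytic-rank `≤ 1` elliptic curves over `ℚ` — "full BSD
formula for every rank `≤ 1` curve in class `C`" assembled STRICTLY from published theorems — so
that the rank-`≤ 1` remainder becomes exactly the CONSTRUCTION-SHAPED classes, which are TYPED
(missing-input `Prop`s), NOT attempted. This is not "finishing BSD". Sub-cell additive-p2: the
classes X3♯(G-ord) / X4♯(G-ord) are CONSTRUCTION-SHAPED and stay so; labels / RESIDUAL-MAP marks
UNCHANGED; nothing is booked. Theorems only; the named facts enter as hypothesis binders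
(`Delbourgo1998.thm1_exists_bounded_evenMeasure` A282, `Delbourgo2002.mainTheorem` A175,
`Delbourgo2002.thmC_charIdeal_dvd_tameBranch` A227, `Delbourgo2002.mainTheorem_potMult`). No
definition, no `sorry`.

## What

Gens 24–25 settled the SHAPE of the per-pair residue of the tame-branch route at RANK ONE on
defect `e ∈ {3,4,6}`: printed facts + THREE finite data (the unit root `ã`, a SIGN CERTIFICATE
deciding `χ` versus `χ⁻¹`, one unit Riemann sum at index `1`). The index-`1` coefficient of the
E-normalised tame branch `B_E` depends on WHICH character is the `𝔭`-ordinary one — hence the sign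
certificate. This file records that at RANK ZERO (the census arm X4-3: 566 X4 + 33 X3 window pairs)
NONE of the three data is needed: the index-`0` coefficient of EVERY witness of the package is
`B(0) = ã⁻¹·[0]⁺_f` (`IsTameBranchOf.constantCoeff`, the (T0) row of Delbourgo 1998 Thm. 1), whose
valuation `ord_p[0]⁺_f` does not see `χ`, and Delbourgo 2002 (C) quantifies over EVERY tuple of the
package. So:

* §1 `charLamLeAt_zero_of_thm1_of_norm_ratPlusSymbol_zero` (general locus: `p ≥ 5`, ADDITIVE,
  (G)-ORDINARY, `e ∈ {3,4,6}`, non-CM): Delbourgo 1998 Thm. 1 + 2002 (A)(C) + the tower bound `p^c`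
  of the plus symbols + `‖[0]⁺_f‖_p = p^c` ⟹ `CharLamLeAt W p 0` (`λ(char_Λ X(E/ℚ_∞)) = 0` for every
  generator). On X4♯(G-ord) (`c = 0`, Drinfeld–Manin): `‖[0]⁺_f‖_p = 1` suffices
  (`ClassX4Gord.charLamLeAt_zero_of_thm1_of_norm_ratPlusSymbol_zero`).
* §2 `ClassX4Gord.padicVal_identity_rankZero_of_thm1_of_norm_ratPlusSymbol_zero`: with 2002 (B)
  and `rank E(ℚ) = 0`: `Ш[p^∞]` finite, `λ(fE) = 0`, `Reg_p = 1`, and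
  **`ord_p #Ш[p^∞] + ord_p ∏c_ℓ + ord_p ℓ = μ(fE) + 2·ord_p #E(ℚ)_tors`** (`ℓ ∣ p²`, `= 1` off the
  anomalous rows) — i.e. `f_E = p^{μ}·unit`: the characteristic power series of `X(E/ℚ_∞)` has NO
  distinguished factor on the unit rows. Reading (`…mu_eq_…`): where `p ∤ #Ш[p^∞]·∏c_ℓ·#tors` (e.g.
  the `p ∤ #Ш_an` rows, on which Kato's bound gives BSD(E,p) — gen 13/16) the identity COMPUTES
  `μ(fE) = ord_p ℓ`, `= 0` off the anomalous rows: there `char_Λ X(E/ℚ_∞) = Λ`.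

Not claimed: `μ` in general (an INTEGRAL (C) off defect 2 is not in print), BSD(E,p), anything at
`L(E,1) = 0`. Nothing booked; X3♯(G-ord)/X4♯(G-ord) stay CONSTRUCTION-SHAPED.

References: Delbourgo, Compositio Math. 113 (1998) Thm. 1 [Delbourgo1998]; J. Number Theory 95 (2002)
Thm. (A), (B), (C) [Delbourgo2002]; Washington, GTM 83, §7.1 [Washington1997]; Manin 1972 Cor. 3.6
[Manin1972]. -/

noncomputable section

open scoped Classical MatrixGroups ModularForm NumberField

open CongruenceSubgroup IsDedekindDomain WeierstrassCurve NumberField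
  Literature.NumberTheory.EllipticCurves
  Literature.NumberTheory.EllipticCurves.ModularForms
  Literature.NumberTheory.EllipticCurves.Rank1Residual
  Literature.NumberTheory.EllipticCurves.Rank1Residual.Typed
  Literature.NumberTheory.EllipticCurves.Delbourgo2002
  Summit.BirchSwinnertonDyer.Rank1Residual.X1.MuLambda

namespace Summit.BirchSwinnertonDyer.Rank1Residual.Additive

namespace TwistPartner

/-! ### §1 `λ(char_Λ X(E/ℚ_∞)) = 0` from print + `ord_p[0]⁺_f` -/

section LamZero

variable {W : WeierstrassCurve ℚ} [W.IsElliptic] [W.IsGloballyMinimal] {p : ℕ} [hp : Fact p.Prime]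
  {N : ℕ} [NeZero N] {f : CuspForm (Gamma0 N) 2}

omit [NeZero N] in
/-- The index-`0` coefficient of every witness of the package has norm `‖[0]⁺_f‖_p` when `‖α‖ = 1`
(`B(0) = α⁻¹·[0]⁺_f`, the (T0) row). [folklore] [cite: Delbourgo1998, Theorem 1 (p. 131)] -/
theorem _root_.Summit.BirchSwinnertonDyer.Rank1Residual.Additive.IsTameBranchOf.norm_coeff_zero
    {ε : DirichletCharacter ℂ_[p] p} {α : ℚ_[p]} {B : PowerSeries ℚ_[p]}
    (h : IsTameBranchOf f p ε α B) (hα : ‖α‖ = 1) :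
    ‖PowerSeries.coeff 0 B‖ = ‖((ratPlusSymbol f 0 : ℚ) : ℚ_[p])‖ := by
  rw [PowerSeries.coeff_zero_eq_constantCoeff_apply, h.constantCoeff, norm_mul, norm_inv, hα,
    inv_one, one_mul]

/-- **`λ(char_Λ X(E/ℚ_∞)) = 0` FROM PRINT + ONE VALUATION** (general locus: `p ≥ 5`, ADDITIVE,
(G)-ORDINARY, defect `e ∈ {3,4,6}`, non-CM). Delbourgo 1998 Thm. 1 (the tame branch EXISTS,
`exists_isTameBranchOf_of_thm1`) + Delbourgo 2002 (A), (C) (named facts) + a tower bound `p^c` of the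
plus symbols + `‖[0]⁺_f‖_p = p^c` ⟹ `CharLamLeAt W p 0`. NO unit root, NO sign certificate, NO
Riemann sum: the index-`0` coefficient of EVERY witness is `ã⁻¹[0]⁺_f`, blind to the character, and
(C) quantifies over every tuple of the package. Nothing booked.
[cite: Delbourgo1998, Theorem 1 (p. 131)] [cite: Delbourgo2002, Theorem (A), (C) (p. 40)]
[cite: Washington1997, §7.1] -/
theorem charLamLeAt_zero_of_thm1_of_norm_ratPlusSymbol_zero
    (hD : Delbourgo1998.thm1_exists_bounded_evenMeasure)
    (hC : Delbourgo2002.thmC_charIdeal_dvd_tameBranch) (hDel : Delbourgo2002.mainTheorem)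
    (hDelM : Delbourgo2002.mainTheorem_potMult) (h5 : 5 ≤ p) (hcm : ¬ W.HasCM) (hadd : Addv W p)
    (hGord : TypeGOrd W p) (he : semistabilityIndex W p ∈ ({3, 4, 6} : Finset ℕ))
    (hf : IsNewformOf W f) {c : ℕ}
    (hc : ∀ (m : ℕ) (a : ℤ), ‖((ratPlusSymbol f ((a : ℚ) / (p : ℚ) ^ m) : ℚ) : ℚ_[p])‖ ≤ (p : ℝ) ^ c)
    (h0 : ‖((ratPlusSymbol f 0 : ℚ) : ℚ_[p])‖ = (p : ℝ) ^ c) : CharLamLeAt W p 0 := by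
  have hp2 : p ≠ 2 := by omega
  have hT : TameBranchRatDvdAt W p := tameBranchRatDvdAt_of_thmC hC hDel hDelM h5 hcm
  obtain ⟨χ₀, ã₀, B, hord, hã₀, hB, hint⟩ := exists_isTameBranchOf_of_thm1 hD h5 hadd hGord he hf
  have hbd : ∀ j : ℕ, ‖PowerSeries.coeff j B‖ ≤ (p : ℝ) ^ c := hint _ hc
  have hk : ‖PowerSeries.coeff 0 B‖ = (p : ℝ) ^ c := by rw [hB.norm_coeff_zero hã₀, h0]
  exact charLamLeAt_of_tameBranchRatDvdAt_of_norm_le_pow_of_norm_coeff_eq_pow hT hp2 hadd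
    (Or.inr hGord) hf hord hã₀ hB hbd hk

/-- **X4♯(G-ord), defect 3, 4, 6, `p ≥ 5`, non-CM: `‖[0]⁺_f‖_p = 1 ⟹ λ(char_Λ X(E/ℚ_∞)) = 0`** from
Delbourgo 1998 Thm. 1, 2002 (A)(C) (named facts) and Drinfeld–Manin integrality (irreducible `E[p]`),
with NO per-pair datum beyond the one valuation. Nothing booked; X4♯(G-ord) CONSTRUCTION-SHAPED.
[cite: Delbourgo1998, Theorem 1 (p. 131)] [cite: Delbourgo2002, Theorem (A), (C) (p. 40)]
[cite: Manin1972, Cor. 3.6] -/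
theorem ClassX4Gord.charLamLeAt_zero_of_thm1_of_norm_ratPlusSymbol_zero
    (hD : Delbourgo1998.thm1_exists_bounded_evenMeasure)
    (hC : Delbourgo2002.thmC_charIdeal_dvd_tameBranch) (hDel : Delbourgo2002.mainTheorem)
    (hDelM : Delbourgo2002.mainTheorem_potMult) (hX : ClassX4Gord W p) (h5 : 5 ≤ p)
    (hcm : ¬ W.HasCM) (he : semistabilityIndex W p ∈ ({3, 4, 6} : Finset ℕ)) (hf : IsNewformOf W f)
    (h0 : ‖((ratPlusSymbol f 0 : ℚ) : ℚ_[p])‖ = 1) : CharLamLeAt W p 0 := by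
  have hc : ∀ (m : ℕ) (a : ℤ),
      ‖((ratPlusSymbol f ((a : ℚ) / (p : ℚ) ^ m) : ℚ) : ℚ_[p])‖ ≤ (p : ℝ) ^ (0 : ℕ) := fun m a ↦ by
    rw [pow_zero]
    exact plusSymbolsPIntegralAt_of_classX4 W p hX.1 f hf _
  exact TwistPartner.charLamLeAt_zero_of_thm1_of_norm_ratPlusSymbol_zero hD hC hDel hDelM h5 hcm
    hX.addv.2 hX.typeGOrd he hf hc (by rw [pow_zero]; exact h0)

/-- **X3♯(G-ord), defect 3, 4, 6, `p ≥ 5`, non-CM** — the twin with the tower bound `p^c` of the plus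
symbols (reducible `E[p]`): `‖[a/p^m]⁺_f‖_p ≤ p^c` for all `m, a` and `‖[0]⁺_f‖_p = p^c` ⟹
`λ(char_Λ X(E/ℚ_∞)) = 0`. Nothing booked; X3♯(G-ord) CONSTRUCTION-SHAPED.
[cite: Delbourgo1998, Theorem 1 (p. 131)] [cite: Delbourgo2002, Theorem (A), (C) (p. 40)] -/
theorem ClassX3Gord.charLamLeAt_zero_of_thm1_of_norm_ratPlusSymbol_zero
    (hD : Delbourgo1998.thm1_exists_bounded_evenMeasure)
    (hC : Delbourgo2002.thmC_charIdeal_dvd_tameBranch) (hDel : Delbourgo2002.mainTheorem)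
    (hDelM : Delbourgo2002.mainTheorem_potMult) (hX : ClassX3Gord W p) (h5 : 5 ≤ p)
    (hcm : ¬ W.HasCM) (he : semistabilityIndex W p ∈ ({3, 4, 6} : Finset ℕ)) (hf : IsNewformOf W f)
    {c : ℕ}
    (hc : ∀ (m : ℕ) (a : ℤ), ‖((ratPlusSymbol f ((a : ℚ) / (p : ℚ) ^ m) : ℚ) : ℚ_[p])‖ ≤ (p : ℝ) ^ c)
    (h0 : ‖((ratPlusSymbol f 0 : ℚ) : ℚ_[p])‖ = (p : ℝ) ^ c) : CharLamLeAt W p 0 :=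
  TwistPartner.charLamLeAt_zero_of_thm1_of_norm_ratPlusSymbol_zero hD hC hDel hDelM h5 hcm hX.addv
    hX.typeGOrd he hf hc h0

end LamZero

/-! ### §2 The rank-zero valuation identity and the reading `μ = ord_p ℓ` on the unit rows -/

section Identity

variable {W : WeierstrassCurve ℚ} [W.IsElliptic] [W.IsGloballyMinimal] {p : ℕ} [hp : Fact p.Prime]
  {N : ℕ} [NeZero N] {f : CuspForm (Gamma0 N) 2}

/-- **THE RANK-ZERO VALUATION IDENTITY FROM PRINT + ONE VALUATION** (general locus: `p ≥ 5`,
ADDITIVE, (G)-ORDINARY, `e ∈ {3,4,6}`, non-CM, `rank_ℤ E(ℚ) = 0`). Delbourgo 1998 Thm. 1 + 2002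
(A)(B)(C) (named facts; (B) through its clause predicate for a height datum `Dh`) + the tower bound
`p^c` of the plus symbols + `‖[0]⁺_f‖_p = p^c` ⟹ for the cyclotomic data and every generator `fE` of
`char_Λ X(E/ℚ_∞)`: `Ш(E)[p^∞]` finite, `λ(fE) = 0`, and
`ord_p #Ш[p^∞] + ord_p Reg_p(Dh) + ord_p ∏c_ℓ + ord_p ℓ = μ(fE) + 2·ord_p #E(ℚ)_tors` with `ℓ ∣ p²`,
`ℓ = 1` off the anomalous rows (`ord_p Reg_p(Dh) = 0` in rank `0`, see the X4 form). NO unit root,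
sign certificate or Riemann sum. Nothing booked. [cite: Delbourgo1998, Theorem 1 (p. 131)]
[cite: Delbourgo2002, Theorem (A), (B), (C) (p. 40)] [cite: Washington1997, §7.1] -/
theorem padicVal_identity_rankZero_of_thm1_of_norm_ratPlusSymbol_zero
    (hD : Delbourgo1998.thm1_exists_bounded_evenMeasure)
    (hC : Delbourgo2002.thmC_charIdeal_dvd_tameBranch) (hDel : Delbourgo2002.mainTheorem)
    (hDelM : Delbourgo2002.mainTheorem_potMult) (h5 : 5 ≤ p) (hcm : ¬ W.HasCM) (hadd : Addv W p)
    (hGord : TypeGOrd W p) (he : semistabilityIndex W p ∈ ({3, 4, 6} : Finset ℕ))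
    (hrk : W.mordellWeilRank = 0) (hf : IsNewformOf W f)
    (hc : ∀ (m : ℕ) (a : ℤ), ‖((ratPlusSymbol f ((a : ℚ) / (p : ℚ) ^ m) : ℚ) : ℚ_[p])‖ ≤ 1)
    (h0 : ‖((ratPlusSymbol f 0 : ℚ) : ℚ_[p])‖ = 1)
    {Dh : PAdicHeightData W p} (hBcl : LeadingTermClauses W p Dh)
    {κ : ZpExtension ℚ p} {γ : Field.absoluteGaloisGroup ℚ}
    (hκ : κ.IsCyclotomic) (hγ : κ.IsTopGenerator γ) (hcv : IsCyclotomicVariable p γ)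
    (D : W.SelmerDualData κ γ) [Module.Finite (IwasawaAlgebra p) D.X]
    {fE : IwasawaAlgebra p} (hchar : D.charIdeal = Ideal.span {fE}) :
    Finite (AddCommGroup.primaryComponent W.sha p) ∧ lam fE = 0 ∧
      ∃ ℓ : ℕ, ℓ ∣ p ^ 2 ∧ (ReductionNonAnomalous W p → ℓ = 1) ∧
        (padicValNat p (Nat.card (AddCommGroup.primaryComponent W.sha p)) : ℤ) +
            (padicRegulator Dh).valuation + padicValNat p W.tamagawaProduct + padicValNat p ℓ =
          mu fE + 2 * padicValNat p W.torsionOrder := by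
  have hp2 : p ≠ 2 := by omega
  have hG : SubGord W p := (subGord_iff_typeG_of_addv W p hp2 hadd).mpr hGord.typeG
  have hT : TameBranchRatDvdAt W p := tameBranchRatDvdAt_of_thmC hC hDel hDelM h5 hcm
  obtain ⟨χ₀, ã₀, B, hord, hã₀, hB, hint⟩ := exists_isTameBranchOf_of_thm1 hD h5 hadd hGord he hf
  have hint1 : ∀ j : ℕ, ‖PowerSeries.coeff j B‖ ≤ 1 := hint _ hc
  have hk : ‖PowerSeries.coeff 0 B‖ = 1 := by rw [hB.norm_coeff_zero hã₀, h0]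
  have h := padicVal_identity_of_tameBranchRatDvdAt_of_cert hT hp2 hadd (Or.inr hGord) hf hord hã₀ hB
    hint1 ⟨0, by rw [hrk], hk⟩ hBcl hκ hγ hcv D hchar
  rw [hrk] at h
  obtain ⟨-, hfin, hlam, ℓ, hℓ, hna, hid⟩ := h
  exact ⟨hfin, hlam, ℓ, hℓ, hna, by simpa using hid⟩

/-- **X4♯(G-ord), defect 3, 4, 6, `rank_ℤ E(ℚ) = 0`, `p ≥ 5`, non-CM: the rank-zero valuation identity
from PRINT + `‖[0]⁺_f‖_p = 1`.** For the cyclotomic data and every generator `fE` of `char_Λ X(E/ℚ_∞)`: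
`Ш(E)[p^∞]` finite, `λ(fE) = 0`, and
**`ord_p #Ш[p^∞] + ord_p ∏c_ℓ + ord_p ℓ = μ(fE) + 2·ord_p #E(ℚ)_tors`** (`ℓ ∣ p²`, `= 1` off the
anomalous rows; the `p`-adic regulator of every height datum is `1` in rank `0`). Inputs: Delbourgo
1998 Thm. 1, 2002 (A)(B)(C), Drinfeld–Manin; NO unit root, sign certificate or Riemann sum — the
rank-zero twin of gen 25's `ClassX4Gord.padicVal_identity_rankOne_of_thm1_of_signCert_of_riemannSum`
with all three finite data gone. Nothing booked; X4♯(G-ord) stays CONSTRUCTION-SHAPED.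
[cite: Delbourgo1998, Theorem 1 (p. 131)] [cite: Delbourgo2002, Theorem (A), (B), (C) (p. 40)]
[cite: Manin1972, Cor. 3.6] [cite: MazurTateTeitelbaum1986Invent, §II.4 (regulator of the empty family)] -/
theorem ClassX4Gord.padicVal_identity_rankZero_of_thm1_of_norm_ratPlusSymbol_zero
    (hD : Delbourgo1998.thm1_exists_bounded_evenMeasure)
    (hC : Delbourgo2002.thmC_charIdeal_dvd_tameBranch) (hDel : Delbourgo2002.mainTheorem)
    (hDelM : Delbourgo2002.mainTheorem_potMult) (hX : ClassX4Gord W p) (h5 : 5 ≤ p) (hcm : ¬ W.HasCM)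
    (he : semistabilityIndex W p ∈ ({3, 4, 6} : Finset ℕ)) (hrk : W.mordellWeilRank = 0)
    (hf : IsNewformOf W f) (h0 : ‖((ratPlusSymbol f 0 : ℚ) : ℚ_[p])‖ = 1)
    {Dh : PAdicHeightData W p} (hBcl : LeadingTermClauses W p Dh)
    {κ : ZpExtension ℚ p} {γ : Field.absoluteGaloisGroup ℚ}
    (hκ : κ.IsCyclotomic) (hγ : κ.IsTopGenerator γ) (hcv : IsCyclotomicVariable p γ)
    (D : W.SelmerDualData κ γ) [Module.Finite (IwasawaAlgebra p) D.X]
    {fE : IwasawaAlgebra p} (hchar : D.charIdeal = Ideal.span {fE}) :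
    Finite (AddCommGroup.primaryComponent W.sha p) ∧ lam fE = 0 ∧
      ∃ ℓ : ℕ, ℓ ∣ p ^ 2 ∧ (ReductionNonAnomalous W p → ℓ = 1) ∧
        (padicValNat p (Nat.card (AddCommGroup.primaryComponent W.sha p)) : ℤ) +
            padicValNat p W.tamagawaProduct + padicValNat p ℓ =
          mu fE + 2 * padicValNat p W.torsionOrder := by
  have hc : ∀ (m : ℕ) (a : ℤ), ‖((ratPlusSymbol f ((a : ℚ) / (p : ℚ) ^ m) : ℚ) : ℚ_[p])‖ ≤ 1 :=
    fun m a ↦ plusSymbolsPIntegralAt_of_classX4 W p hX.1 f hf _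
  obtain ⟨hfin, hlam, ℓ, hℓ, hna, hid⟩ :=
    TwistPartner.padicVal_identity_rankZero_of_thm1_of_norm_ratPlusSymbol_zero hD hC hDel hDelM h5 hcm
      hX.addv.2 hX.typeGOrd he hrk hf hc h0 hBcl hκ hγ hcv D hchar
  haveI : Finite W.toAffine.Point := W.finite_point_of_rank_zero hrk
  have hreg : padicRegulator Dh = 1 := padicRegulator_eq_one_of_finite W p Dh
  rw [hreg, Padic.valuation_one, add_zero] at hid
  exact ⟨hfin, hlam, ℓ, hℓ, hna, hid⟩

/-- **READING: `μ(X(E/ℚ_∞)) = ord_p ℓ` on the unit rows of X4-3.** X4♯(G-ord), defect 3, 4, 6,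
`rank_ℤ E(ℚ) = 0`, `p ≥ 5`, non-CM, `‖[0]⁺_f‖_p = 1`: if moreover `p ∤ #Ш(E)[p^∞]`, `p ∤ ∏c_ℓ` and
`p ∤ #E(ℚ)_tors` (e.g. the `p ∤ #Ш_an` rows, where Kato's bound gives BSD(E,p) — gens 13/16), then
every generator `fE` of `char_Λ X(E/ℚ_∞)` has `λ(fE) = 0` AND `μ(fE) = ord_p ℓ` (`ℓ ∣ p²`), so
**`μ(fE) = 0` off the anomalous rows — `char_Λ X(E/ℚ_∞)` is trivial there** — from Delbourgo 1998
Thm. 1, 2002 (A)(B)(C) and the three valuations. Nothing booked.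
[cite: Delbourgo1998, Theorem 1 (p. 131)] [cite: Delbourgo2002, Theorem (A), (B), (C) (p. 40)]
[cite: Washington1997, §7.1] -/
theorem ClassX4Gord.lam_eq_zero_and_mu_eq_rankZero_of_thm1_of_units
    (hD : Delbourgo1998.thm1_exists_bounded_evenMeasure)
    (hC : Delbourgo2002.thmC_charIdeal_dvd_tameBranch) (hDel : Delbourgo2002.mainTheorem)
    (hDelM : Delbourgo2002.mainTheorem_potMult) (hX : ClassX4Gord W p) (h5 : 5 ≤ p) (hcm : ¬ W.HasCM)
    (he : semistabilityIndex W p ∈ ({3, 4, 6} : Finset ℕ)) (hrk : W.mordellWeilRank = 0)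
    (hf : IsNewformOf W f) (h0 : ‖((ratPlusSymbol f 0 : ℚ) : ℚ_[p])‖ = 1)
    (hSha : padicValNat p (Nat.card (AddCommGroup.primaryComponent W.sha p)) = 0)
    (hTam : padicValNat p W.tamagawaProduct = 0) (htors : padicValNat p W.torsionOrder = 0)
    {Dh : PAdicHeightData W p} (hBcl : LeadingTermClauses W p Dh)
    {κ : ZpExtension ℚ p} {γ : Field.absoluteGaloisGroup ℚ}
    (hκ : κ.IsCyclotomic) (hγ : κ.IsTopGenerator γ) (hcv : IsCyclotomicVariable p γ)
    (D : W.SelmerDualData κ γ) [Module.Finite (IwasawaAlgebra p) D.X]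
    {fE : IwasawaAlgebra p} (hchar : D.charIdeal = Ideal.span {fE}) :
    lam fE = 0 ∧ ∃ ℓ : ℕ, ℓ ∣ p ^ 2 ∧ (ReductionNonAnomalous W p → ℓ = 1) ∧
      mu fE = padicValNat p ℓ := by
  obtain ⟨-, hlam, ℓ, hℓ, hna, hid⟩ :=
    ClassX4Gord.padicVal_identity_rankZero_of_thm1_of_norm_ratPlusSymbol_zero hD hC hDel hDelM hX h5
      hcm he hrk hf h0 hBcl hκ hγ hcv D hchar
  rw [hSha, hTam, htors] at hid
  refine ⟨hlam, ℓ, hℓ, hna, ?_⟩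
  simp only [Nat.cast_zero, zero_add, mul_zero, add_zero] at hid
  exact_mod_cast hid.symm

/-- **`μ = λ = 0` OFF THE ANOMALOUS ROWS** (same hypotheses + `ReductionNonAnomalous W p`): every
generator `fE` of `char_Λ X(E/ℚ_∞)` is a UNIT of `Λ` up to `λ = μ = 0` — the Iwasawa module of the
(G)-ordinary additive curve over the cyclotomic tower has trivial characteristic ideal on the unit,
binder-clean, non-anomalous rows of X4-3. Nothing booked. [cite: Delbourgo1998, Theorem 1 (p. 131)]
[cite: Delbourgo2002, Theorem (A), (B), (C) (p. 40)] [cite: Washington1997, §7.1] -/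
theorem ClassX4Gord.lam_eq_zero_and_mu_eq_zero_rankZero_of_thm1_of_units_of_nonAnomalous
    (hD : Delbourgo1998.thm1_exists_bounded_evenMeasure)
    (hC : Delbourgo2002.thmC_charIdeal_dvd_tameBranch) (hDel : Delbourgo2002.mainTheorem)
    (hDelM : Delbourgo2002.mainTheorem_potMult) (hX : ClassX4Gord W p) (h5 : 5 ≤ p) (hcm : ¬ W.HasCM)
    (he : semistabilityIndex W p ∈ ({3, 4, 6} : Finset ℕ)) (hrk : W.mordellWeilRank = 0)
    (hf : IsNewformOf W f) (h0 : ‖((ratPlusSymbol f 0 : ℚ) : ℚ_[p])‖ = 1)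
    (hSha : padicValNat p (Nat.card (AddCommGroup.primaryComponent W.sha p)) = 0)
    (hTam : padicValNat p W.tamagawaProduct = 0) (htors : padicValNat p W.torsionOrder = 0)
    (hna : ReductionNonAnomalous W p)
    {Dh : PAdicHeightData W p} (hBcl : LeadingTermClauses W p Dh)
    {κ : ZpExtension ℚ p} {γ : Field.absoluteGaloisGroup ℚ}
    (hκ : κ.IsCyclotomic) (hγ : κ.IsTopGenerator γ) (hcv : IsCyclotomicVariable p γ)
    (D : W.SelmerDualData κ γ) [Module.Finite (IwasawaAlgebra p) D.X]
    {fE : IwasawaAlgebra p} (hchar : D.charIdeal = Ideal.span {fE}) :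
    lam fE = 0 ∧ mu fE = 0 := by
  obtain ⟨hlam, ℓ, -, hℓ1, hmu⟩ :=
    ClassX4Gord.lam_eq_zero_and_mu_eq_rankZero_of_thm1_of_units hD hC hDel hDelM hX h5 hcm he hrk hf
      h0 hSha hTam htors hBcl hκ hγ hcv D hchar
  refine ⟨hlam, ?_⟩
  rw [hmu, hℓ1 hna, padicValNat_one_right]

end Identity

/-! ### §3 The X3♯(G-ord) twin of the rank-zero identity (plus symbols bounded by `p^c`) -/

section IdentityX3

variable {W : WeierstrassCurve ℚ} [W.IsElliptic] [W.IsGloballyMinimal] {p : ℕ} [hp : Fact p.Prime]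
  {N : ℕ} [NeZero N] {f : CuspForm (Gamma0 N) 2}

/-- **X3♯(G-ord), defect 3, 4, 6, `rank_ℤ E(ℚ) = 0`, `p ≥ 5`, non-CM: the rank-zero valuation identity
from PRINT + the tower bound `p^c` of the plus symbols + `‖[0]⁺_f‖_p = p^c`** (reducible `E[p]`: the
plus symbols need not be `p`-integral, the certificate sits AT THE BOUND). For the cyclotomic data and
every generator `fE` of `char_Λ X(E/ℚ_∞)`: `Ш(E)[p^∞]` finite, `λ(fE) = 0`, and
`ord_p #Ш[p^∞] + ord_p ∏c_ℓ + ord_p ℓ = μ(fE) + 2·ord_p #E(ℚ)_tors` (`ℓ ∣ p²`, `= 1` off the anomalous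
rows; `Reg_p = 1` in rank `0`). Inputs: Delbourgo 1998 Thm. 1, 2002 (A)(B)(C) as binders; NO unit root,
sign certificate or Riemann sum (`ClassX3Gord.charLamLeAt_zero_of_thm1_of_norm_ratPlusSymbol_zero` +
n1011-p01's `padicVal_identity_of_charLamLe`). Nothing booked; X3♯(G-ord) stays CONSTRUCTION-SHAPED.
[cite: Delbourgo1998, Theorem 1 (p. 131)] [cite: Delbourgo2002, Theorem (A), (B), (C) (p. 40)]
[cite: Washington1997, §7.1] [cite: MazurTateTeitelbaum1986Invent, §II.4 (regulator of the empty family)] -/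
theorem ClassX3Gord.padicVal_identity_rankZero_of_thm1_of_norm_ratPlusSymbol_zero
    (hD : Delbourgo1998.thm1_exists_bounded_evenMeasure)
    (hC : Delbourgo2002.thmC_charIdeal_dvd_tameBranch) (hDel : Delbourgo2002.mainTheorem)
    (hDelM : Delbourgo2002.mainTheorem_potMult) (hX : ClassX3Gord W p) (h5 : 5 ≤ p) (hcm : ¬ W.HasCM)
    (he : semistabilityIndex W p ∈ ({3, 4, 6} : Finset ℕ)) (hrk : W.mordellWeilRank = 0)
    (hf : IsNewformOf W f) {c : ℕ}
    (hc : ∀ (m : ℕ) (a : ℤ), ‖((ratPlusSymbol f ((a : ℚ) / (p : ℚ) ^ m) : ℚ) : ℚ_[p])‖ ≤ (p : ℝ) ^ c)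
    (h0 : ‖((ratPlusSymbol f 0 : ℚ) : ℚ_[p])‖ = (p : ℝ) ^ c)
    {Dh : PAdicHeightData W p} (hBcl : LeadingTermClauses W p Dh)
    {κ : ZpExtension ℚ p} {γ : Field.absoluteGaloisGroup ℚ}
    (hκ : κ.IsCyclotomic) (hγ : κ.IsTopGenerator γ) (hcv : IsCyclotomicVariable p γ)
    (D : W.SelmerDualData κ γ) [Module.Finite (IwasawaAlgebra p) D.X]
    {fE : IwasawaAlgebra p} (hchar : D.charIdeal = Ideal.span {fE}) :
    Finite (AddCommGroup.primaryComponent W.sha p) ∧ lam fE = 0 ∧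
      ∃ ℓ : ℕ, ℓ ∣ p ^ 2 ∧ (ReductionNonAnomalous W p → ℓ = 1) ∧
        (padicValNat p (Nat.card (AddCommGroup.primaryComponent W.sha p)) : ℤ) +
            padicValNat p W.tamagawaProduct + padicValNat p ℓ =
          mu fE + 2 * padicValNat p W.torsionOrder := by
  have hp2 : p ≠ 2 := by omega
  have hlam0 : CharLamLeAt W p 0 :=
    ClassX3Gord.charLamLeAt_zero_of_thm1_of_norm_ratPlusSymbol_zero hD hC hDel hDelM hX h5 hcm he hf hc h0
  have hlam : lam fE ≤ W.mordellWeilRank := by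
    rw [hrk]
    exact hlam0 κ γ hκ hγ hcv D fE hchar
  have hXt : D.IsTorsion :=
    Delbourgo2002.mainTheorem.isTorsion hDel h5 hcm hX.addv hX.typeGOrd hκ hγ D
  obtain ⟨-, hfin, hlam', ℓ, hℓ, hna, hid⟩ :=
    padicVal_identity_of_charLamLe W p hBcl hp2 hκ hγ hcv D hXt hchar hlam
  rw [hrk] at hlam' hid
  haveI : Finite W.toAffine.Point := W.finite_point_of_rank_zero hrk
  have hreg : padicRegulator Dh = 1 := padicRegulator_eq_one_of_finite W p Dh
  rw [hreg, Padic.valuation_one, add_zero] at hid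
  refine ⟨hfin, hlam', ℓ, hℓ, hna, ?_⟩
  simpa using hid

end IdentityX3

end TwistPartner

end Summit.BirchSwinnertonDyer.Rank1Residual.Additive

end
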